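import Literature.NumberTheory.Transcendental.L2HodgeTheory
import Literature.Geometry.Kaehler.RiemannianHodgeAdjointProofs
import HarnessLib

/-!
# Exact and co-exact forms are `L²`-orthogonal (Warner, Thm. 6.8) — proofs

Topic: real `L²` Hodge theory on a closed oriented Riemannian manifold,
`Literature/NumberTheory/Transcendental/L2HodgeTheory.lean` (the `L²` product
`Literature.Geometry.Kaehler.MForm.l2Inner o α β = ∫_M ⟪α, β⟫ vol_o` and
`Literature.NumberTheory.Transcendental.IsL2Orthogonal`). Source: F. W. Warner, *Foundations of
Differentiable Manifolds and Lie Groups*, GTM 94 (1983), Ch. 6, where throughout "`M` will be a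
compact oriented Riemannian manifold of dimension `n`" (p. 220; manifolds are Hausdorff, second
countable and without boundary, Def. 1.3; metrics are `C^∞`): the inner product
`⟨α, β⟩ = ∫_M α ∧ *β` (6.1 (5), p. 220), `δ` is the adjoint of `d` (Prop. 6.2, p. 220), and the
Hodge decomposition `E^p(M) = d(E^{p-1}) ⊕ δ(E^{p+1}) ⊕ H^p` is an *orthogonal* direct sum
(Thm. 6.8 (1), p. 223), the orthogonality `d(E^{p-1}) ⟂ δ(E^{p+1})` being
`⟨dα, δβ⟩ = ⟨ddα, β⟩ = 0` ("the other two lines of (1) then follow from 6.1(3), 6.2, and 6.3",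
proof of 6.8, p. 223).

## Main statements (all proved)

* `Literature.Geometry.Kaehler.MForm.l2Inner_mextDeriv_left_of_isSmoothForm` — **Prop. 6.2** in
  `L²` form: `⟪dα, β⟫ = ⟪α, δβ⟫` for smooth `α ∈ E^k(M)`, `β ∈ E^{k+1}(M)` on a compact boundaryless
  oriented Riemannian manifold with smooth metric (from the wedge form
  `Literature.Geometry.Kaehler.integral_mextDeriv_wedge_hodgeStar`, i.e. Stokes, and the pointwise
  identity `α ∧ ⋆β = ⟪α, β⟫ vol`, `Literature.Geometry.Kaehler.MForm.wedge_hodgeStar`).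
* `Literature.NumberTheory.Transcendental.exists_eq_mcoderiv_of_mem_span_mcoderiv`: the span of the
  co-exact forms `δ(E^{k+1}(M))` is already that image (`δ` is linear on smooth forms).
* `Literature.NumberTheory.Transcendental.isL2Orthogonal_exactSmoothForms_span_mcoderiv` —
  **Thm. 6.8 (1), third line, orthogonality of the first two summands**: exact smooth
  `(k+1)`-forms are `L²`-orthogonal to co-exact smooth `(k+1)`-forms, `⟪dα, δγ⟫ = ⟪ddα, γ⟫ = 0`.
* `Literature.NumberTheory.Transcendental.isL2Orthogonal_exact_coexact_of_compactSpace`: in the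
  presence of the intended instances (`CompactSpace M`, `I.Boundaryless`, continuous and `C^∞`
  metric) the named fact `isL2Orthogonal_exact_coexact o` of `L2HodgeTheory.lean` holds as
  declared.
* (Appended.) The closed named fact
  `Literature.NumberTheory.Transcendental.isL2Orthogonal_exact_coexact_closedManifold` — Thm. 6.8 (1)
  with `[T2Space M] [CompactSpace M] [IsManifold I ∞ M] [I.Boundaryless]
  [IsContinuousRiemannianBundle E _] [IsContMDiffRiemannianBundle I ∞ E _]` bound inside the
  statement — and its discharge `…_closedManifold_holds`.

## Why `isL2Orthogonal_exact_coexact` is not discharged outright (provefact pass, 2026-08-15)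

The named fact `Literature.NumberTheory.Transcendental.isL2Orthogonal_exact_coexact`
(`def … : Prop`) was written in a section
`variable [CompactSpace M] [I.Boundaryless] [IsContinuousRiemannianBundle E _]
[IsContMDiffRiemannianBundle I ∞ E _]`, but a `def` does not abstract section instances its body
does not use: `#check @isL2Orthogonal_exact_coexact` binds only
`[T2Space M] [SigmaCompactSpace M] [IsManifold I ∞ M] [RiemannianBundle _] (o) {k m}`. As
elaborated it therefore quantifies over *non-compact* manifolds (where `MForm.integral`, a
`finsum` of Bochner integrals against a partition of unity chosen by `Classical.choose`, is a
junk value carrying no information), over manifolds *with boundary* (where the statement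
fails classically: on the closed unit disk `D ⊂ ℝ²` one has `δ(y vol) = -⋆dy = dx`, so
`⟪dx, δ(y vol)⟫ = ⟪dx, dx⟫ = π ≠ 0` — the boundary term `-∫_{∂D} y dx` that Warner's identity
`⟨dα, β⟩ - ⟨α, δβ⟩ = ∫_M d(α ∧ *β)` acquires when `∂M ≠ ∅`), and over fibre metrics of no
regularity (where `δγ` of a smooth `γ` is a junk value). Warner's hypotheses (compact, no
boundary, smooth metric; p. 220) are exactly the dropped instances. Following the provefact protocol (a mis-stated named fact is
corrected under a new name, never edited in place) this file proves the result under the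
intended instances (`isL2Orthogonal_exactSmoothForms_span_mcoderiv`) and the bridge
`isL2Orthogonal_exact_coexact_of_compactSpace`; the corrected *closed* named fact
`isL2Orthogonal_exact_coexact_closedManifold` (all hypotheses bound inside the statement) and its
discharge `isL2Orthogonal_exact_coexact_closedManifold_holds` are appended (section
*CorrectedFact*, reviewed follow-up).
The same dropped-instance defect affects every `def` of `section Closed` of
`L2HodgeTheory.lean` (`l2Inner_add_left`, `l2Inner_self_eq_zero_iff`, `l2Inner_mextDeriv_left`,
`l2Inner_hodgeLaplacian_comm`, `l2Inner_hodgeLaplacian_self_nonneg`,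
`isL2Orthogonal_harmonicForms_exactSmoothForms`, `isL2Orthogonal_harmonicForms_coexact`,
`existsUnique_greenOperator`, `hodgeStar_mem_harmonicForms`, `finrank_harmonicForms_eq`);
`MForm.l2Inner_eq_integral_wedge_hodgeStar` (no analytic content) is correctly stated (and is
discharged in the sibling file `L2HodgeTheoryProofs.lean`).

## References

* F. W. Warner, *Foundations of Differentiable Manifolds and Lie Groups*, GTM 94, Springer
  (1983): 6.1 (5) (p. 220), Prop. 6.2 (pp. 220–221), Thm. 6.8 (1) and its proof (p. 223).

## Verdict clean-up note (2026-08-15)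

The named fact `isL2Orthogonal_exact_coexact` is now an `@[deprecated]` record of
`L2HodgeTheory.lean` (mis-stated, resp. refuted as stated: a `def` does not abstract the unused
section instances it was written under; the corrected statements are the ones proved or named in
this file and in the records' docstrings). The declaration
`isL2Orthogonal_exact_coexact_of_compactSpace` names the record on purpose, so `linter.deprecated`
is silenced on exactly that declaration (REMOVE-WHEN the records are deleted from
`L2HodgeTheory.lean`).
-/

noncomputable section

open scoped Manifold ContDiff Topology
open Bundle Module Set Function
open Literature.Geometry.Kaehler

namespace Literature.NumberTheory.Transcendental

variable {E : Type*} [NormedAddCommGroup E] [NormedSpace ℝ E] [FiniteDimensional ℝ E]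
  {n : ℕ} [Fact (finrank ℝ E = n)]
  {H : Type*} [TopologicalSpace H] {I : ModelWithCorners ℝ E H}
  {M : Type*} [TopologicalSpace M] [ChartedSpace H M] [IsManifold I ∞ M]
  [RiemannianBundle (fun x : M ↦ TangentSpace I x)]
  (o : (x : M) → Orientation ℝ (TangentSpace I x) (Fin n)) {k m : ℕ}

/-! ### Co-exact forms: the span of `δ(E^{k+1})` is `δ(E^{k+1})` -/

section Coexact

variable [IsContMDiffRiemannianBundle I ∞ E (fun x : M ↦ TangentSpace I x)]

/-- **Co-exact forms are codifferentials.** Under a `C^∞` metric with `vol_o` smooth, every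
element of the span of `δ(E^{k+1}(M)) = mcoderiv o h '' smoothForms` is itself `δγ` for a smooth
`(k+1)`-form `γ`: `δ` is additive on smooth forms (`mcoderiv_add`, the Hodge stars being smooth by
`IsSmoothForm.hodgeStar`) and homogeneous (`mcoderiv_smul`), so the image is already a subspace
(Warner (1983), 6.1, p. 220: `δ` is a linear operator `E^p(M) → E^{p-1}(M)`; used in Thm. 6.8 (1),
p. 223, where `δ(E^{p+1})` denotes this subspace). [cite: WarnerGTM94, 6.1, p. 220] -/
theorem exists_eq_mcoderiv_of_mem_span_mcoderiv (ho : IsSmoothForm (riemannianVolumeForm o))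
    (h : (k + 1) + m = n) {β : MForm I M ℝ k}
    (hβ : β ∈ Submodule.span ℝ (mcoderiv o h ''
      (smoothForms I M ℝ (k + 1) : Set (MForm I M ℝ (k + 1))))) :
    ∃ γ : MForm I M ℝ (k + 1), IsSmoothForm γ ∧ mcoderiv o h γ = β := by
  refine Submodule.span_induction
    (p := fun β _ ↦ ∃ γ : MForm I M ℝ (k + 1), IsSmoothForm γ ∧ mcoderiv o h γ = β)
    ?_ ?_ ?_ ?_ hβ
  · rintro _ ⟨γ, hγ, rfl⟩
    exact ⟨γ, hγ, rfl⟩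
  · exact ⟨0, isSmoothForm_zero, by simp [mcoderiv, mextDeriv_zero]⟩
  · rintro _ _ - - ⟨γ₁, hγ₁, rfl⟩ ⟨γ₂, hγ₂, rfl⟩
    exact ⟨γ₁ + γ₂, hγ₁.add hγ₂, mcoderiv_add o h (IsSmoothForm.hodgeStar o ho h hγ₁)
      (IsSmoothForm.hodgeStar o ho h hγ₂)⟩
  · rintro c _ - ⟨γ, hγ, rfl⟩
    exact ⟨c • γ, hγ.smul c, mcoderiv_smul o h c γ⟩

end Coexact

/-! ### Closed manifolds: adjointness in `L²` form and the orthogonality `d(E^k) ⟂ δ(E^{k+2})` -/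

section Closed

variable [MeasurableSpace E] [BorelSpace E] [T2Space M] [CompactSpace M] [I.Boundaryless]
  [IsContinuousRiemannianBundle E (fun x : M ↦ TangentSpace I x)]
  [IsContMDiffRiemannianBundle I ∞ E (fun x : M ↦ TangentSpace I x)]

/-- **`δ` is the adjoint of `d` in the `L²` inner product** (Warner (1983), Prop. 6.2, p. 220):
`⟪dα, β⟫_{L²} = ⟪α, δβ⟫_{L²}` for a smooth `k`-form `α` and a smooth `(k+1)`-form `β` on a compact
oriented Riemannian manifold without boundary (Hausdorff, `C^∞` manifold and metric, `vol_o`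
smooth; degrees via `h : (k + 1) + m = n` as for `mcoderiv`). Proof: both sides are wedge
integrals `∫_M dα ∧ ⋆β`, `∫_M α ∧ ⋆δβ` (Warner 6.1 (5)), equal by
`integral_mextDeriv_wedge_hodgeStar` (Warner's proof: `d(α ∧ *β) = dα ∧ *β - α ∧ *δβ` and Stokes),
whose integrands are `⟪dα, β⟫ vol` and `⟪α, δβ⟫ vol` pointwise (`MForm.wedge_hodgeStar`). This is
the statement of the named fact `MForm.l2Inner_mextDeriv_left` of `L2HodgeTheory.lean` under the
instances its `def` dropped. [cite: WarnerGTM94, Prop. 6.2, p. 220] -/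
theorem _root_.Literature.Geometry.Kaehler.MForm.l2Inner_mextDeriv_left_of_isSmoothForm
    (ho : IsSmoothForm (riemannianVolumeForm o)) (h : (k + 1) + m = n) {α : MForm I M ℝ k}
    {β : MForm I M ℝ (k + 1)} (hα : IsSmoothForm α) (hβ : IsSmoothForm β) :
    MForm.l2Inner o (mextDeriv α) β = MForm.l2Inner o α (mcoderiv o h β) := by
  have hadj := integral_mextDeriv_wedge_hodgeStar o ho h hα hβ
  rw [MForm.wedge_hodgeStar, MForm.wedge_hodgeStar] at hadj
  exact hadj

/-- **Exact and co-exact forms are `L²`-orthogonal** (Warner (1983), Thm. 6.8 (1), p. 223: the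
decomposition `E^p(M) = d(E^{p-1}) ⊕ δ(E^{p+1}) ⊕ H^p` is an orthogonal direct sum; here the
orthogonality of the first two summands, in positive degree `p = k + 1`): on a compact oriented
Riemannian manifold without boundary (Hausdorff, `C^∞` manifold and metric, `vol_o` smooth),
`⟪α, β⟫_{L²} = 0` for every exact smooth `(k+1)`-form `α` and every `β` in the span of the
co-exact forms `δγ`, `γ ∈ E^{k+2}(M)` (co-exact forms typed as in `HodgeTheorem.lean`,
`h : (k + 1 + 1) + m = n`). Proof as printed (p. 223, "follow from … 6.2"): `α = dα'` with `α'`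
smooth (`exists_eq_mextDeriv_of_mem_exactSmoothForms`), `β = δγ` with `γ` smooth
(`exists_eq_mcoderiv_of_mem_span_mcoderiv`), and
`⟪dα', δγ⟫ = ⟪ddα', γ⟫ = ⟪0, γ⟫ = 0` by Prop. 6.2 (`MForm.l2Inner_mextDeriv_left_of_isSmoothForm`)
and `d ∘ d = 0` (`mextDeriv_mextDeriv`). [cite: WarnerGTM94, Thm. 6.8 (1), p. 223] -/
theorem isL2Orthogonal_exactSmoothForms_span_mcoderiv
    (ho : IsSmoothForm (riemannianVolumeForm o)) (h : (k + 1 + 1) + m = n) :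
    IsL2Orthogonal o (exactSmoothForms I M ℝ (k + 1) : Set (MForm I M ℝ (k + 1)))
      (Submodule.span ℝ (mcoderiv o h ''
        (smoothForms I M ℝ (k + 1 + 1) : Set (MForm I M ℝ (k + 1 + 1))))) := by
  intro α hα β hβ
  obtain ⟨α', hα', rfl⟩ := exists_eq_mextDeriv_of_mem_exactSmoothForms hα
  obtain ⟨γ, hγ, rfl⟩ := exists_eq_mcoderiv_of_mem_span_mcoderiv o ho h hβ
  have hdα' : IsSmoothForm (mextDeriv α') :=
    isSmoothForm_mextDeriv (inChart_mextDeriv_holds I M ℝ) hα'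
  rw [← MForm.l2Inner_mextDeriv_left_of_isSmoothForm o ho h hdα' hγ,
    mextDeriv_mextDeriv (inChart_mextDeriv_holds I M ℝ) hα']
  simpa using MForm.l2Inner_smul_left o (0 : ℝ) (0 : MForm I M ℝ (k + 1 + 1)) γ

-- names the `@[deprecated]` record `isL2Orthogonal_exact_coexact` on purpose (verdict clean-up 2026-08-15); REMOVE-WHEN the
-- record is deleted from `L2HodgeTheory.lean`
set_option linter.deprecated false in
/-- **Bridge to the named fact as declared.** In the presence of the intended instances
(`CompactSpace M`, `I.Boundaryless`, continuous and `C^∞` Riemannian metric) the named fact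
`isL2Orthogonal_exact_coexact o` of `L2HodgeTheory.lean` — whose `def` dropped exactly these
instances, see the module docstring — holds: its body quantifies `ho` and `h` itself and is then
`isL2Orthogonal_exactSmoothForms_span_mcoderiv`. Warner (1983), Thm. 6.8 (1), p. 223.
[cite: WarnerGTM94, Thm. 6.8 (1), p. 223] -/
theorem isL2Orthogonal_exact_coexact_of_compactSpace :
    isL2Orthogonal_exact_coexact (k := k) (m := m) o :=
  fun ho h ↦ isL2Orthogonal_exactSmoothForms_span_mcoderiv o ho h

end Closed

/-! ### The corrected named fact (Warner, Thm. 6.8 (1)) -/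

section CorrectedFact

/-- **Warner's Theorem 6.8 (1), orthogonality of exact and co-exact forms, as a closed named fact,
correctly stated.** On a compact oriented Riemannian manifold `M` without boundary (Hausdorff,
`C^∞` manifold, `C^∞` metric, orientation family `o` with `vol_o` smooth), exact smooth
`(k+1)`-forms are `L²`-orthogonal to co-exact smooth `(k+1)`-forms: `⟪α, β⟫_{L²} = 0` for all
`α ∈ d(E^k(M))` and all `β` in (the span of) `δ(E^{k+2}(M))` — F. W. Warner, *Foundations of
Differentiable Manifolds and Lie Groups*, GTM 94 (1983), Thm. 6.8 (1), p. 223: the Hodge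
decomposition `E^p(M) = d(E^{p-1}) ⊕ δ(E^{p+1}) ⊕ H^p` is an orthogonal direct sum (here the
orthogonality of its first two summands, `p = k + 1 ≥ 1`; `⟨dα, δβ⟩ = ⟨ddα, β⟩ = 0` by Prop. 6.2
and `d² = 0`, proof of 6.8, p. 223; standing hypothesis p. 220: "`M` will be a compact oriented
Riemannian manifold of dimension `n`"). **Correction** of the named fact
`Literature.NumberTheory.Transcendental.isL2Orthogonal_exact_coexact` of `L2HodgeTheory.lean`:
that `def … : Prop` was written after
`variable [CompactSpace M] [I.Boundaryless] [IsContinuousRiemannianBundle E _]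
[IsContMDiffRiemannianBundle I ∞ E _]`, but a `def` does not abstract unused section instances,
so its elaborated statement binds only `[T2Space M] [SigmaCompactSpace M] [IsManifold I ∞ M]
[RiemannianBundle _]`: it quantifies over non-compact manifolds (where `MForm.integral` is a junk
value), over manifolds with boundary (where it fails: on the closed unit disk
`⟪dx, δ(y vol)⟫ = ⟪dx, dx⟫ = π ≠ 0`) and over fibre metrics of no regularity. Here the hypotheses
`[CompactSpace M] [I.Boundaryless] [IsContinuousRiemannianBundle E _]
[IsContMDiffRiemannianBundle I ∞ E _]` (with `[T2Space M] [IsManifold I ∞ M]`) are binders *of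
the statement*; the co-exact forms are typed as in `isL2Orthogonal_exact_coexact`
(`h : (k + 1 + 1) + m = n`, `mcoderiv o h '' smoothForms`). Discharged by
`isL2Orthogonal_exact_coexact_closedManifold_holds`; the usable form is
`Literature.NumberTheory.Transcendental.isL2Orthogonal_exactSmoothForms_span_mcoderiv`.
[cite: WarnerGTM94, Thm. 6.8 (1), p. 223] -/
def isL2Orthogonal_exact_coexact_closedManifold : Prop :=
  ∀ {E : Type*} [NormedAddCommGroup E] [NormedSpace ℝ E] [FiniteDimensional ℝ E] {n : ℕ}
    [Fact (finrank ℝ E = n)] [MeasurableSpace E] [BorelSpace E]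
    {H : Type*} [TopologicalSpace H] {I : ModelWithCorners ℝ E H}
    {M : Type*} [TopologicalSpace M] [ChartedSpace H M] [T2Space M] [CompactSpace M]
    [IsManifold I ∞ M] [I.Boundaryless] [RiemannianBundle (fun x : M ↦ TangentSpace I x)]
    [IsContinuousRiemannianBundle E (fun x : M ↦ TangentSpace I x)]
    [IsContMDiffRiemannianBundle I ∞ E (fun x : M ↦ TangentSpace I x)] {k m : ℕ}
    (o : (x : M) → Orientation ℝ (TangentSpace I x) (Fin n)),
    IsSmoothForm (riemannianVolumeForm o) → ∀ h : (k + 1 + 1) + m = n,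
      IsL2Orthogonal o (exactSmoothForms I M ℝ (k + 1) : Set (MForm I M ℝ (k + 1)))
        (Submodule.span ℝ (mcoderiv o h ''
          (smoothForms I M ℝ (k + 1 + 1) : Set (MForm I M ℝ (k + 1 + 1)))))

/-- **Discharge** of `isL2Orthogonal_exact_coexact_closedManifold` (the corrected form of the
named fact `isL2Orthogonal_exact_coexact`): immediate from
`isL2Orthogonal_exactSmoothForms_span_mcoderiv`. Warner (1983), Thm. 6.8 (1), p. 223.
[cite: WarnerGTM94, Thm. 6.8 (1), p. 223] -/
theorem isL2Orthogonal_exact_coexact_closedManifold_holds :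
    isL2Orthogonal_exact_coexact_closedManifold :=
  fun o ho h ↦ isL2Orthogonal_exactSmoothForms_span_mcoderiv o ho h

end CorrectedFact

end Literature.NumberTheory.Transcendental
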